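import Summits.ABC.ABC.Theorems.TwistAmplificationSharpModerateLawDefs
import Literature.NumberTheory.Sieve.DivisorBound
import Literature.NumberTheory.DiophantineGeometry.StrongHall
import Mathlib.NumberTheory.Harmonic.Bounds
import Mathlib.Analysis.SpecialFunctions.Pow.Real
import Mathlib.Data.Nat.Factorization.Basic
import Mathlib.Data.Nat.Squarefree

/-!
# Crux `TwistAmplification.SharpModerateLaw` (stmt-ABC-1975), stub `stub_fieldSum`: arithmetic lemmas

Elementary inputs for the field sum `Σ_{0<|D|≤N} h_max(D)/rad(D) ≪_ε N^ε` of the line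
`syzygy-lattice-half-deep-few-primes` (file `TwistAmplificationSharpModerateLawFieldSum.lean`; this is its registered support file
`TwistAmplificationSharpModerateLawFieldSumLemmas.lean`, support statement `fieldSumLemmas_main`):

* `depthRad` (Kane's repeated radical `v(n) = rad(n / rad n)`, `…Defs.lean`) through factorizations
  (`v_p(rad n) = [p ∣ n]` is the tree's `DiophantineGeometry.factorization_radical_apply`):
  `factorization_depthRad` (`v_p(v(n)) = [p² ∣ n]`), `depthRad_sq_dvd` (`v(n)² ∣ n`),
  `squarefree_depthRad`, `depthRad_pos`, `depthRad_le`, and **`dvd_mul_depthRad_mul_radical`**: if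
  `2⁴ ∤ n`, `3⁶ ∤ n` and `p³ ∤ n` for every prime `p ≥ 5` (the shape of a maximal cubic
  discriminant) then `n ∣ 324 · v(n) · rad n`, so `1/rad n ≤ 324 v(n)/n`;
* `exists_six_pow_card_primeFactors_le` — `6^{ω(q)} ≤ M_δ q^δ` (from the divisor bound `τ(q) ≪ q^δ`
  of `Literature.NumberTheory.Sieve.DivisorBound` and `2^{ω} ≤ τ`);
* **`sum_div_natAbs_le_of_partial_sums_le`** — Abel summation in the form used: if `c ≥ 0` on `ℤ`
  and `Σ_{0<|D|≤M} c(D) ≤ K·M` for all `M ≥ 1`, then `Σ_{0<|D|≤N} c(D)/|D| ≤ K (1 + log N)`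
  (with `Σ_{m ≤ N} 1/m ≤ 1 + log N`, Mathlib's `harmonic_le_one_add_log`);
* `one_add_log_le_rpow` — `1 + log N ≤ (1 + 1/δ) N^δ`.
-/

noncomputable section

namespace Summit.ABC.ABC.Theorems.SharpModerateLaw

open UniqueFactorizationMonoid (radical radical_dvd_self radical_ne_zero)
open Finset Real

/-! ## A. The repeated radical through factorizations -/

/-- `v_p(v(n)) = [p² ∣ n]` for `n ≠ 0`, `p` prime, `v = depthRad`. [folklore] -/
theorem factorization_depthRad {n p : ℕ} (hn : n ≠ 0) (hp : p.Prime) :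
    (depthRad n).factorization p = if p ^ 2 ∣ n then 1 else 0 := by
  have hrad : radical n ∣ n := radical_dvd_self
  have hm : n / radical n ≠ 0 := by
    intro h0
    rcases (Nat.div_eq_zero_iff).mp h0 with h | h
    · exact (radical_ne_zero h).elim
    · exact absurd (Nat.le_of_dvd (Nat.pos_of_ne_zero hn) hrad) (not_le.mpr h)
  rw [depthRad, Literature.NumberTheory.DiophantineGeometry.factorization_radical_apply hm hp]
  have hdiv : (n / radical n).factorization p = n.factorization p - (radical n).factorization p := by
    rw [Nat.factorization_div hrad]; rfl
  have key : p ∣ n / radical n ↔ p ^ 2 ∣ n := by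
    rw [hp.dvd_iff_one_le_factorization hm, hp.pow_dvd_iff_le_factorization hn, hdiv,
      Literature.NumberTheory.DiophantineGeometry.factorization_radical_apply hn hp]
    by_cases hpn : p ∣ n
    · rw [if_pos hpn]
      have := (hp.dvd_iff_one_le_factorization hn).mp hpn
      omega
    · rw [if_neg hpn]
      have : n.factorization p = 0 := Nat.factorization_eq_zero_of_not_dvd hpn
      omega
  by_cases h : p ^ 2 ∣ n
  · rw [if_pos h, if_pos (key.mpr h)]
  · rw [if_neg h, if_neg (fun h' => h (key.mp h'))]

/-- `v(n)` is positive. [folklore] -/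
theorem depthRad_pos (n : ℕ) : 0 < depthRad n := Nat.radical_pos _

/-- `v(n)` is squarefree. [folklore] -/
theorem squarefree_depthRad (n : ℕ) : Squarefree (depthRad n) :=
  UniqueFactorizationMonoid.squarefree_radical

/-- `v(n) ∣ n`. [folklore] -/
theorem depthRad_dvd (n : ℕ) : depthRad n ∣ n :=
  (radical_dvd_self (a := n / radical n)).trans (Nat.div_dvd_of_dvd radical_dvd_self)

/-- `v(n) ≤ n` for `n ≠ 0`. [folklore] -/
theorem depthRad_le {n : ℕ} (hn : n ≠ 0) : depthRad n ≤ n :=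
  Nat.le_of_dvd (Nat.pos_of_ne_zero hn) (depthRad_dvd n)

/-- `v(n)² ∣ n`. [folklore] -/
theorem depthRad_sq_dvd {n : ℕ} (hn : n ≠ 0) : depthRad n ^ 2 ∣ n := by
  rw [← Nat.factorization_le_iff_dvd (pow_ne_zero 2 (depthRad_pos n).ne') hn, Nat.factorization_pow]
  intro p
  rw [Finsupp.smul_apply, smul_eq_mul]
  by_cases hp : p.Prime
  · rw [factorization_depthRad hn hp]
    split_ifs with h
    · exact (hp.pow_dvd_iff_le_factorization hn).mp h
    · simp
  · simp [Nat.factorization_eq_zero_of_not_prime _ hp]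

/-- **The shape bound.** If `2⁴ ∤ n`, `3⁶ ∤ n` and `p³ ∤ n` for all primes `p ≥ 5` (the
discriminant of a maximal cubic ring), then `n ∣ 324 · v(n) · rad n`. [folklore] -/
theorem dvd_mul_depthRad_mul_radical {n : ℕ} (hn : n ≠ 0) (h2 : ¬ 2 ^ 4 ∣ n) (h3 : ¬ 3 ^ 6 ∣ n)
    (h5 : ∀ p : ℕ, p.Prime → 5 ≤ p → ¬ p ^ 3 ∣ n) : n ∣ 324 * depthRad n * radical n := by
  have hv0 : depthRad n ≠ 0 := (depthRad_pos n).ne'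
  have hr0 : radical n ≠ 0 := radical_ne_zero
  rw [← Nat.factorization_le_iff_dvd hn (by positivity), Nat.factorization_mul (by positivity) hr0,
    Nat.factorization_mul (by norm_num) hv0]
  intro p
  simp only [Finsupp.add_apply]
  by_cases hp : p.Prime
  · rw [factorization_depthRad hn hp, Literature.NumberTheory.DiophantineGeometry.factorization_radical_apply hn hp]
    have hv : ∀ k, ¬ p ^ k ∣ n → n.factorization p < k := fun k hk => by
      rw [hp.pow_dvd_iff_le_factorization hn] at hk; omega
    by_cases hpn : p ∣ n
    · rw [if_pos hpn]
      by_cases hp2 : p ^ 2 ∣ n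
      · rw [if_pos hp2]
        by_cases h2' : p = 2
        · subst h2'
          have : 2 ≤ (324 : ℕ).factorization 2 :=
            (Nat.prime_two.pow_dvd_iff_le_factorization (by norm_num)).mp (by norm_num)
          have := hv 4 h2
          omega
        by_cases h3' : p = 3
        · subst h3'
          have : 4 ≤ (324 : ℕ).factorization 3 :=
            (Nat.prime_three.pow_dvd_iff_le_factorization (by norm_num)).mp (by norm_num)
          have := hv 6 h3
          omega
        · have := hv 3 (h5 p hp (hp.five_le_of_ne_two_of_ne_three h2' h3'))
          omega
      · rw [if_neg hp2]
        have := hv 2 hp2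
        omega
    · rw [Nat.factorization_eq_zero_of_not_dvd hpn]
      exact Nat.zero_le _
  · simp [Nat.factorization_eq_zero_of_not_prime _ hp]

/-- The shape bound as a real inequality: `1/rad n ≤ 324 · v(n)/n`. [folklore] -/
theorem inv_radical_le {n : ℕ} (hn : n ≠ 0) (h2 : ¬ 2 ^ 4 ∣ n) (h3 : ¬ 3 ^ 6 ∣ n)
    (h5 : ∀ p : ℕ, p.Prime → 5 ≤ p → ¬ p ^ 3 ∣ n) :
    1 / ((radical n : ℕ) : ℝ) ≤ 324 * (depthRad n : ℝ) / n := by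
  have hpos : 0 < 324 * depthRad n * radical n :=
    Nat.mul_pos (Nat.mul_pos (by norm_num) (depthRad_pos n)) (Nat.radical_pos n)
  have h := Nat.le_of_dvd hpos (dvd_mul_depthRad_mul_radical hn h2 h3 h5)
  have h' : (n : ℝ) ≤ 324 * (depthRad n : ℝ) * (radical n : ℕ) := by exact_mod_cast h
  have hr : (0 : ℝ) < ((radical n : ℕ) : ℝ) := by exact_mod_cast Nat.radical_pos n
  have hn' : (0 : ℝ) < n := by exact_mod_cast Nat.pos_of_ne_zero hn
  rw [div_le_div_iff₀ hr hn']
  linarith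

/-! ## B. `6^{ω(q)} ≪_δ q^δ` and harmonic sums -/

/-- **`6^{ω(q)} ≤ M q^δ`** for every `δ > 0` (from `6^ω ≤ 8^ω ≤ τ³` and the divisor bound). [folklore] -/
theorem exists_six_pow_card_primeFactors_le {δ : ℝ} (hδ : 0 < δ) :
    ∃ M : ℝ, 1 ≤ M ∧ ∀ q : ℕ, q ≠ 0 → (6 : ℝ) ^ q.primeFactors.card ≤ M * (q : ℝ) ^ δ := by
  obtain ⟨C, hC1, hC⟩ := Literature.NumberTheory.Sieve.exists_card_divisors_le_mul_rpow
    (show 0 < δ / 3 by positivity)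
  refine ⟨C ^ 3, one_le_pow₀ hC1, fun q hq => ?_⟩
  have h1 : (6 : ℝ) ^ q.primeFactors.card ≤ ((2 : ℝ) ^ q.primeFactors.card) ^ 3 := by
    rw [← pow_mul, mul_comm, pow_mul]
    exact pow_le_pow_left₀ (by norm_num) (by norm_num) _
  have h2 : (2 : ℝ) ^ q.primeFactors.card ≤ (q.divisors.card : ℝ) := by
    have h2' : 2 ^ q.primeFactors.card ≤ q.divisors.card := by
      rw [Nat.card_divisors hq]
      exact Finset.pow_card_le_prod _ _ _ fun p hp => by
        have := (Nat.mem_primeFactors.mp hp).1.factorization_pos_of_dvd hq (Nat.dvd_of_mem_primeFactors hp)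
        omega
    exact_mod_cast h2'
  have h3 := hC q hq
  have hq0 : (0 : ℝ) ≤ (q : ℝ) ^ (δ / 3) := by positivity
  calc (6 : ℝ) ^ q.primeFactors.card ≤ ((2 : ℝ) ^ q.primeFactors.card) ^ 3 := h1
    _ ≤ (C * (q : ℝ) ^ (δ / 3)) ^ 3 := by
        exact pow_le_pow_left₀ (by positivity) (h2.trans h3) 3
    _ = C ^ 3 * (q : ℝ) ^ δ := by
        rw [mul_pow, ← Real.rpow_natCast ((q : ℝ) ^ (δ / 3)) 3, ← Real.rpow_mul (Nat.cast_nonneg q)]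
        norm_num

/-- `1 + log N ≤ (1 + 1/δ) N^δ` for `N ≥ 1`, `δ > 0`. [folklore] -/
theorem one_add_log_le_rpow {δ : ℝ} (hδ : 0 < δ) {N : ℕ} (hN : 1 ≤ N) :
    1 + Real.log N ≤ (1 + 1 / δ) * (N : ℝ) ^ δ := by
  have hN' : (1 : ℝ) ≤ N := by exact_mod_cast hN
  have h1 : (1 : ℝ) ≤ (N : ℝ) ^ δ := Real.one_le_rpow hN' hδ.le
  have h2 : Real.log N ≤ (N : ℝ) ^ δ / δ := Real.log_le_rpow_div (by linarith) hδ
  calc 1 + Real.log N ≤ (N : ℝ) ^ δ + (N : ℝ) ^ δ / δ := add_le_add h1 h2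
    _ = (1 + 1 / δ) * (N : ℝ) ^ δ := by ring

/-! ## C. Abel summation over `0 < |D| ≤ N` -/

/-- The symmetric range `0 < |D| ≤ N`. [folklore] -/
theorem symmRange_succ (N : ℕ) : (Icc (-((N + 1 : ℕ) : ℤ)) ((N + 1 : ℕ) : ℤ)).erase 0 =
    insert ((N : ℤ) + 1) (insert (-((N : ℤ) + 1)) ((Icc (-(N : ℤ)) N).erase 0)) := by
  ext D
  simp only [mem_erase, mem_Icc, mem_insert, Nat.cast_add, Nat.cast_one]
  omega

/-- **Abel summation, in the form used.** If `c ≥ 0` and `Σ_{0<|D|≤M} c(D) ≤ K·M` for all `M ≥ 1`,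
then `Σ_{0<|D|≤N} c(D)/|D| ≤ K·(1 + log N)` for `N ≥ 1`. [folklore] -/
theorem sum_div_natAbs_le_of_partial_sums_le (c : ℤ → ℝ) (hc : ∀ D, 0 ≤ c D) {K : ℝ} (hK : 0 ≤ K)
    (hC : ∀ M : ℕ, 1 ≤ M → ∑ D ∈ (Icc (-(M : ℤ)) M).erase 0, c D ≤ K * M) {N : ℕ} (hN : 1 ≤ N) :
    ∑ D ∈ (Icc (-(N : ℤ)) N).erase 0, c D / (D.natAbs : ℝ) ≤ K * (1 + Real.log N) := by
  -- `T N − C N / N ≤ K Σ_{m=2}^{N} 1/m` by induction on `N ≥ 1`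
  have key : ∀ N : ℕ, 1 ≤ N →
      ∑ D ∈ (Icc (-(N : ℤ)) N).erase 0, c D / (D.natAbs : ℝ) -
        (∑ D ∈ (Icc (-(N : ℤ)) N).erase 0, c D) / N ≤ K * ∑ m ∈ Icc 2 N, (1 : ℝ) / m := by
    intro N hN
    induction N, hN using Nat.le_induction with
    | base =>
      have h1 : (Icc (-((1 : ℕ) : ℤ)) ((1 : ℕ) : ℤ)).erase 0 = {1, -1} := by decide
      rw [h1]
      simp
    | succ N hN ih =>
      have hnot1 : ((N : ℤ) + 1) ∉ insert (-((N : ℤ) + 1)) ((Icc (-(N : ℤ)) N).erase 0) := by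
        simp only [mem_insert, mem_erase, mem_Icc]; omega
      have hnot2 : (-((N : ℤ) + 1)) ∉ (Icc (-(N : ℤ)) N).erase 0 := by
        simp only [mem_erase, mem_Icc]; omega
      have habs1 : (((N : ℤ) + 1).natAbs : ℝ) = N + 1 := by
        rw [show ((N : ℤ) + 1) = ((N + 1 : ℕ) : ℤ) by push_cast; ring, Int.natAbs_natCast]; push_cast; ring
      have habs2 : ((-((N : ℤ) + 1)).natAbs : ℝ) = N + 1 := by
        rw [Int.natAbs_neg, show ((N : ℤ) + 1) = ((N + 1 : ℕ) : ℤ) by push_cast; ring, Int.natAbs_natCast]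
        push_cast; ring
      rw [symmRange_succ N, sum_insert hnot1, sum_insert hnot2, sum_insert hnot1, sum_insert hnot2,
        habs1, habs2, Finset.sum_Icc_succ_top (by omega : 2 ≤ N + 1)]
      set T : ℝ := ∑ D ∈ (Icc (-(N : ℤ)) N).erase 0, c D / (D.natAbs : ℝ)
      set S : ℝ := ∑ D ∈ (Icc (-(N : ℤ)) N).erase 0, c D
      have hS : S ≤ K * N := hC N hN
      have hS0 : 0 ≤ S := Finset.sum_nonneg fun D _ => hc D
      have hNpos : (0 : ℝ) < N := by exact_mod_cast hN
      push_cast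
      have hstep : S / N - S / (N + 1) ≤ K * (1 / (N + 1)) := by
        rw [div_sub_div _ _ hNpos.ne' (by linarith), div_le_iff₀ (by positivity)]
        have : K * (1 / ((N : ℝ) + 1)) * (N * (N + 1)) = K * N := by field_simp
        rw [this]
        nlinarith
      have : c ((N : ℤ) + 1) / ((N : ℝ) + 1) + (c (-((N : ℤ) + 1)) / ((N : ℝ) + 1) + T) -
          (c ((N : ℤ) + 1) + (c (-((N : ℤ) + 1)) + S)) / ((N : ℝ) + 1) = T - S / (N + 1) := by
        field_simp; ring
      rw [this]
      linarith
  have h := key N hN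
  have hS : (∑ D ∈ (Icc (-(N : ℤ)) N).erase 0, c D) / N ≤ K := by
    rw [div_le_iff₀ (by exact_mod_cast hN)]
    exact hC N hN
  have hharm : ∑ m ∈ Icc 2 N, (1 : ℝ) / m ≤ Real.log N := by
    have h1 : ∑ q ∈ Icc 1 N, (1 : ℝ) / q ≤ 1 + Real.log N := by
      have h := harmonic_le_one_add_log N
      rw [harmonic_eq_sum_Icc] at h
      push_cast at h
      simpa only [one_div] using h
    rw [← Finset.insert_Icc_add_one_left_eq_Icc hN, sum_insert (by simp)] at h1
    norm_num at h1 ⊢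
    linarith
  have hsum : ∑ D ∈ (Icc (-(N : ℤ)) N).erase 0, c D / (D.natAbs : ℝ) ≤
      (∑ D ∈ (Icc (-(N : ℤ)) N).erase 0, c D) / N + K * ∑ m ∈ Icc 2 N, (1 : ℝ) / m := by linarith
  calc ∑ D ∈ (Icc (-(N : ℤ)) N).erase 0, c D / (D.natAbs : ℝ)
      ≤ (∑ D ∈ (Icc (-(N : ℤ)) N).erase 0, c D) / N + K * ∑ m ∈ Icc 2 N, (1 : ℝ) / m := hsum
    _ ≤ K + K * Real.log N := add_le_add hS (mul_le_mul_of_nonneg_left hharm hK)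
    _ = K * (1 + Real.log N) := by ring

/-! ## D. Registered support statement -/

/-- Registered support statement `fieldSumLemmas_main` of crux stmt-ABC-1975 (main export of this file,
the shape bound): if `2⁴ ∤ n`, `3⁶ ∤ n` and `p³ ∤ n` for all primes `p ≥ 5`, then `n ∣ 324·v(n)·rad n`. -/
theorem fieldSumLemmas_main : ∀ n : ℕ, n ≠ 0 → ¬ 2 ^ 4 ∣ n → ¬ 3 ^ 6 ∣ n → (∀ p : ℕ, p.Prime → 5 ≤ p → ¬ p ^ 3 ∣ n) → n ∣ 324 * depthRad n * radical n :=
  fun _ hn h2 h3 h5 => dvd_mul_depthRad_mul_radical hn h2 h3 h5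

end Summit.ABC.ABC.Theorems.SharpModerateLaw

end
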